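import Literature.NumberTheory.Automorphic.ValuedFieldValuativeRelBridge   -- ★ `Valued`/`ValuativeRel` dictionary; brings ★ `CartanUnique.v_uniformizer_zpow`
import Literature.NumberTheory.Automorphic.HeckeTransversalGL               -- ★ `diagonal_mul_mul_diagonal_apply`
import HarnessLib

/-!
# Projective descent and lattice levels: when is `s · ι(g)` integral, resp. Iwahori, in terms of the homothety class of `g`
(Serre, *Trees* II.1.1–1.3: vertices of the tree of `SL₂(F)` = homothety classes of lattices, `GL₂(F)` acts through `PGL₂(F)`, the stabiliser of
an edge contains its inversions; Tits (1979) §2.7, §3.9: at a RAMIFIED quadratic `E ∕ F` the building of the quasi-split unitary group in two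
variables is the tree of `SL₂(F)`, the two maximal compact subgroups being a vertex and an edge stabiliser)

Topic `NumberTheory/Automorphic`; namespace `Literature.NumberTheory.Automorphic` (generic over two `ℤᵐ⁰`-valued fields; the unitary ∕ place dischargers are in the
companion file).  KERNEL mathematics only: theorems, no definition, no named fact, no instance, no notation, no `sorry`.  Cell
`pub/hodgecm-mathlib`, F0∕P3a, crux H413 = `stmt-HodgeConjecture-24833`, line «N6nsGerm», residue «R2EP-wild» of `stub_N6nsR2EP` — ROAD W brick
**(W2)-CORE** (census of record `F0/P3a/F0P3a-p04/g13/MEMO-R2wild.F0P3a-p04g13.md` §1 (S4); owner B-p14 (g32), (W1c)+(W2) holder B-p08 (g28); seat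
F0P3a-p04 (g14)).  HONEST LABEL: HC_CM is proved only modulo the printed citations until rung 0 closes; nothing printed is asserted here.

THE MATHEMATICS.  Let `ι : F → E` be a field embedding of (rank-one, `ℤᵐ⁰`-valued) valued fields with `v_E(ι x) = v_F(x)^e` (`e` the ramification
index), `ϖ` a uniformiser of `F`, and `M = s · ι(g)` (`s ∈ E`, `g ∈ M₂(F)`) a matrix with `v_E(det M) = 1` — by ★ `exists_conj_diagonal_eq_smul_map_toPlace`
(W1, p843570) this is the shape of `diag(1,α) u diag(1,α)⁻¹` for every `u` in the quasi-split unitary group `U(σ, Φ₂)(E_w)` at a non-split place, `σα = −α`,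
and `v(det M) = v(det u) = 1` (companion file).  Write `U(h)` for «`h` has integral entries and unit determinant» (`= h ∈ GL₂(𝒪_F)`, spelled out, no definition),
`Λ₀ = 𝒪_F²`, `D = diag(1, ϖ)`, `Λ₁ = DΛ₀`; recall `U(ϖ^k g) ⟺ ϖ^k g Λ₀ = Λ₀`, `U(D⁻¹ ϖ^k g D) ⟺ ϖ^k g Λ₁ = Λ₁`, `U(D⁻¹ ϖ^k g) ⟺ ϖ^k g Λ₀ = Λ₁`,
`U(ϖ^k g D) ⟺ ϖ^k g Λ₁ = Λ₀` (★ `latt_le_latt_iff`, `mapGL_latt_eq`; the tree side, (W1c)).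
* (A) VERTEX (`e ≠ 0` arbitrary) `forall_v_smul_map_le_one_iff_exists_zpow_smul`: **`M` integral ⟺ ∃ k, U(ϖ^k g)`** ⟺ `[g] ∈ PGL₂(F)` fixes `Λ₀`.
  (⇒ rescale by the largest entry of `g`; `v(det M) = 1` forces the rescaled determinant to be a unit. ⇐ the scalar is then a unit.)  Transported
  along `D` (C) `diagonal_map_inv_mul_smul_map_mul_diagonal_map(_two)`: `forall_v_conj_map_smul_map_le_one_iff_exists_zpow_smul` (the vertex `Λ₁`).
* (B) EDGE (`e = 2`, `π` a uniformiser of `E`) `forall_v_conj_smul_map_le_one_iff_of_sq`: **`diag(1,π)⁻¹ M diag(1,π)` integral** (i.e. `M` stabilises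
  `𝒪_E ⊕ π𝒪_E`) **⟺ (∃k U(ϖ^k g)) ∧ (∃k U(D⁻¹ ϖ^k g D)) ∨ (∃k U(D⁻¹ ϖ^k g)) ∧ (∃k U(ϖ^k g D))** ⟺ `[g]` fixes the edge `{Λ₀, Λ₁}` pointwise OR
  inverts it — literally the `hKe : s(act g v₀, act g v₁) = s(v₀, v₁)` shape of ★ `natCard_fixedBy_add_eq_natCard_fixedBy_add_one_of_treeAction` (B-p14,
  W3∕W4).  Proof: entries of `ι(g)` have EVEN `E`-valuation and `v_E(s) = v_F(det g)⁻¹`; everything is linear bookkeeping on exponents, the parity of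
  `v_F(det g)` choosing the branch (odd = inversion: the element `Φ₂ ∈ U` inverts an edge at a ramified place — Kottwitz's Euler–Poincaré function then
  lives on the barycentric subdivision).
* COMPANION ★ `ProjectiveDescentLatticeLevelsDischarge`: the hypotheses `hι` (`e = 2` at a ramified non-split place), `he`, `hdet` (`|det u| = 1` on
  `U(σ, Φ₂)`), the `glInt` bridge and the diagonal bookkeeping `u = d_α⁻¹ M d_α`, `d_η⁻¹(d_α⁻¹ M d_α)d_η = d_{αη}⁻¹ M d_{αη}`, plus the (W2) dictionary
  (`K`∕`K♯` ↔ (A)∕(B) by the parity of `ord α`).  NOT here: the tree action `ρ` and the stabiliser statements themselves ((W1c), (W2): B-p08), orbits (S3).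

## References
* [Serre1980Trees] J.-P. Serre, *Trees* (1980), Ch. II §1.1–§1.3.
* [Tits1979] J. Tits, *Reductive groups over local fields*, PSPM 33.1 (1979), §2.7, §3.9.
* [Rogawski1990] J. D. Rogawski, *Automorphic Representations of Unitary Groups in Three Variables* (1990), §3.6 p. 31.
* [Serre1979] J.-P. Serre, *Local Fields* (1979), Ch. I §1, Ch. II §1.
-/

set_option autoImplicit false

noncomputable section

open scoped WithZero Matrix MatrixGroups
open Matrix WithZero

namespace Literature.NumberTheory.Automorphic

/-! ## §0 Arithmetic of `ℤᵐ⁰` -/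

section WithZeroInt

/-- In `ℤᵐ⁰`, `y² ≤ exp m ↔ y ≤ exp ⌊m∕2⌋`. [cite: Serre1979, Ch. I §1 and Ch. II §1] -/
theorem pow_two_le_exp_iff_le_exp_ediv_two (y : ℤᵐ⁰) (m : ℤ) : y ^ 2 ≤ exp m ↔ y ≤ exp (m / 2) := by
  by_cases hy : y = 0
  · subst hy; simp
  · rw [← exp_log hy, ← WithZero.exp_nsmul, exp_le_exp, exp_le_exp, nsmul_eq_mul, Nat.cast_ofNat]
    omega

/-- In `ℤᵐ⁰`, `y ^ n = exp (n • a)` with `n ≠ 0` forces `y = exp a`. [cite: Serre1979, Ch. I §1 and Ch. II §1] -/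
theorem eq_exp_of_pow_eq_exp_nsmul {y : ℤᵐ⁰} {n : ℕ} (hn : n ≠ 0) {a : ℤ} (h : y ^ n = exp (n • a)) : y = exp a := by
  have hy : y ≠ 0 := by
    rintro rfl
    rw [zero_pow hn] at h
    exact exp_ne_zero h.symm
  rw [← exp_log hy, ← WithZero.exp_nsmul, exp_inj] at h
  rw [← exp_log hy, exp_inj]
  have : (n : ℤ) * log y = (n : ℤ) * a := by simpa [nsmul_eq_mul] using h
  exact mul_left_cancel₀ (by exact_mod_cast hn) this

/-- In `ℤᵐ⁰`, `exp a · y ≤ 1 ↔ y ≤ exp (−a)`. [cite: Serre1979, Ch. I §1 and Ch. II §1] -/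
theorem exp_mul_le_one_iff (a : ℤ) (y : ℤᵐ⁰) : exp a * y ≤ 1 ↔ y ≤ exp (-a) := by
  by_cases hy : y = 0
  · subst hy; simp
  · rw [← exp_log hy, ← WithZero.exp_add, ← WithZero.exp_zero, exp_le_exp, exp_le_exp]
    omega

/-- In `ℤᵐ⁰`, `exp a · y² ≤ 1 ↔ y ≤ exp ⌊−a∕2⌋`. [cite: Serre1979, Ch. I §1 and Ch. II §1] -/
theorem exp_mul_pow_two_le_one_iff (a : ℤ) (y : ℤᵐ⁰) : exp a * y ^ 2 ≤ 1 ↔ y ≤ exp (-a / 2) := by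
  rw [exp_mul_le_one_iff, pow_two_le_exp_iff_le_exp_ediv_two]

/-- `exp a · exp b · y ≤ 1 ↔ y ≤ exp (−(a+b))`. [cite: Serre1979, Ch. I §1 and Ch. II §1] -/
theorem exp_mul_exp_mul_le_one_iff (a b : ℤ) (y : ℤᵐ⁰) : exp a * exp b * y ≤ 1 ↔ y ≤ exp (-(a + b)) := by
  rw [← WithZero.exp_add, exp_mul_le_one_iff]

/-- `exp a · exp b · exp c · y ≤ 1 ↔ y ≤ exp (−(a+b+c))`. [cite: Serre1979, Ch. I §1 and Ch. II §1] -/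
theorem exp_mul_exp_mul_exp_mul_le_one_iff (a b c : ℤ) (y : ℤᵐ⁰) : exp a * exp b * exp c * y ≤ 1 ↔ y ≤ exp (-(a + b + c)) := by
  rw [← WithZero.exp_add, ← WithZero.exp_add, exp_mul_le_one_iff]

/-- `exp a · exp b · exp c · y² ≤ 1 ↔ y ≤ exp ⌊−(a+b+c)∕2⌋`. [cite: Serre1979, Ch. I §1 and Ch. II §1] -/
theorem exp_mul_exp_mul_exp_mul_pow_two_le_one_iff (a b c : ℤ) (y : ℤᵐ⁰) :
    exp a * exp b * exp c * y ^ 2 ≤ 1 ↔ y ≤ exp (-(a + b + c) / 2) := by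
  rw [← WithZero.exp_add, ← WithZero.exp_add, exp_mul_pow_two_le_one_iff]

/-- Monotonicity in the exponent: `y ≤ exp a`, `a ≤ b` ⟹ `y ≤ exp b`. [cite: Serre1979, Ch. I §1 and Ch. II §1] -/
theorem le_exp_of_le_exp_of_le {y : ℤᵐ⁰} {a b : ℤ} (h : y ≤ exp a) (hab : a ≤ b) : y ≤ exp b :=
  h.trans (exp_le_exp.2 hab)

end WithZeroInt

/-! ## §1 Two valued fields `ι : F → E` with `v_E ∘ ι = v_F ^ e`: integrality of `s · ι(g)` versus the homothety class of `g` -/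

section TwoFields

variable {F E : Type*} [Field F] [Field E] [Valued F ℤᵐ⁰] [Valued E ℤᵐ⁰] (ι : F →+* E) {e : ℕ}

/-- `v_E(det ι(g)) = v_F(det g)^e`. [cite: Serre1979, Ch. I §1 and Ch. II §1] -/
theorem v_det_map_eq_pow (hι : ∀ x, Valued.v (ι x) = Valued.v x ^ e) {n : ℕ} (g : Matrix (Fin n) (Fin n) F) :
    Valued.v (g.map ι).det = Valued.v g.det ^ e := by
  rw [← RingHom.mapMatrix_apply, ← RingHom.map_det, hι]

/-- `v_E(det (s · ι g)) = v_E(s)² · v_F(det g)^e` for `2 × 2` matrices. [cite: Serre1979, Ch. I §1 and Ch. II §1] -/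
theorem v_det_smul_map_two (hι : ∀ x, Valued.v (ι x) = Valued.v x ^ e) (s : E) (g : Matrix (Fin 2) (Fin 2) F) :
    Valued.v (s • g.map ι).det = Valued.v s ^ 2 * Valued.v g.det ^ e := by
  rw [Matrix.det_smul, Fintype.card_fin, map_mul, map_pow, v_det_map_eq_pow ι hι]

/-- Valuation of the entries of `diag(a) · (s · ι g) · diag(b)`. [cite: Serre1980Trees, Ch. II §1.1–§1.3] -/
theorem v_diagonal_mul_smul_map_mul_diagonal_apply (hι : ∀ x, Valued.v (ι x) = Valued.v x ^ e) (a b : Fin 2 → E) (s : E)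
    (g : Matrix (Fin 2) (Fin 2) F) (i j : Fin 2) :
    Valued.v ((diagonal a * (s • g.map ι) * diagonal b) i j) = Valued.v (a i) * Valued.v (b j) * Valued.v s * Valued.v (g i j) ^ e := by
  rw [diagonal_mul_mul_diagonal_apply, Matrix.smul_apply, Matrix.map_apply, smul_eq_mul, map_mul, map_mul, map_mul, hι]
  ac_rfl

omit [Valued E ℤᵐ⁰] in
/-- Valuation of the entries of `diag(a) · (ϖ^k g) · diag(b)`, `v ϖ = exp(−1)`. [cite: Serre1979, Ch. I §1 and Ch. II §1] -/
theorem v_diagonal_mul_zpow_smul_mul_diagonal_apply {ϖ : F} (hϖ : Valued.v ϖ = exp (-1 : ℤ)) (a b : Fin 2 → F) (k : ℤ)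
    (g : Matrix (Fin 2) (Fin 2) F) (i j : Fin 2) :
    Valued.v ((diagonal a * (ϖ ^ k • g) * diagonal b) i j) = Valued.v (a i) * Valued.v (b j) * exp (-k) * Valued.v (g i j) := by
  rw [diagonal_mul_mul_diagonal_apply, Matrix.smul_apply, smul_eq_mul, map_mul, map_mul, map_mul, CartanUnique.v_uniformizer_zpow hϖ]
  ac_rfl

omit [Valued E ℤᵐ⁰] in
/-- Valuation of the entries of `diag(a) · (ϖ^k g)`. [cite: Serre1979, Ch. I §1 and Ch. II §1] -/
theorem v_diagonal_mul_zpow_smul_apply {ϖ : F} (hϖ : Valued.v ϖ = exp (-1 : ℤ)) (a : Fin 2 → F) (k : ℤ)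
    (g : Matrix (Fin 2) (Fin 2) F) (i j : Fin 2) :
    Valued.v ((diagonal a * (ϖ ^ k • g)) i j) = Valued.v (a i) * exp (-k) * Valued.v (g i j) := by
  rw [diagonal_mul, Matrix.smul_apply, smul_eq_mul, map_mul, map_mul, CartanUnique.v_uniformizer_zpow hϖ, mul_assoc]

omit [Valued E ℤᵐ⁰] in
/-- Valuation of the entries of `(ϖ^k g) · diag(b)`. [cite: Serre1979, Ch. I §1 and Ch. II §1] -/
theorem v_zpow_smul_mul_diagonal_apply {ϖ : F} (hϖ : Valued.v ϖ = exp (-1 : ℤ)) (b : Fin 2 → F) (k : ℤ)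
    (g : Matrix (Fin 2) (Fin 2) F) (i j : Fin 2) :
    Valued.v ((ϖ ^ k • g * diagonal b) i j) = Valued.v (b j) * exp (-k) * Valued.v (g i j) := by
  rw [mul_diagonal, Matrix.smul_apply, smul_eq_mul, map_mul, map_mul, CartanUnique.v_uniformizer_zpow hϖ]
  ac_rfl

omit [Valued E ℤᵐ⁰] in
/-- Valuation of the entries of `ϖ^k g`. [cite: Serre1979, Ch. I §1 and Ch. II §1] -/
theorem v_zpow_smul_apply {ϖ : F} (hϖ : Valued.v ϖ = exp (-1 : ℤ)) (k : ℤ) (g : Matrix (Fin 2) (Fin 2) F) (i j : Fin 2) :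
    Valued.v ((ϖ ^ k • g) i j) = exp (-k) * Valued.v (g i j) := by
  rw [Matrix.smul_apply, smul_eq_mul, map_mul, CartanUnique.v_uniformizer_zpow hϖ]

/-- **VERTEX LEVEL (homothety classes of `GL₂(𝒪_F)`).**  Let `ι : F → E` multiply valuations by `e ≠ 0` (`v_E(ι x) = v_F(x)^e`), `ϖ` a
uniformiser of `F`, and `M := s · ι(g)` a `2 × 2` matrix with `v_E(det M) = 1`.  Then `M` has `v_E`-integral entries (i.e. `M ∈ GL₂(𝒪_E)`) iff some
`F`-homothetic `ϖ^k · g` lies in `GL₂(𝒪_F)` (integral entries, unit determinant) — i.e. iff the class `[g] ∈ PGL₂(F)` fixes the standard vertex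
`𝒪_F²` of the tree of `SL₂(F)`.  (⇒: rescale by the largest entry of `g`; the unit determinant of `M` forces the rescaled determinant to be a unit.)
[cite: Serre1980Trees, Ch. II §1.1–§1.3] -/
theorem forall_v_smul_map_le_one_iff_exists_zpow_smul (hι : ∀ x, Valued.v (ι x) = Valued.v x ^ e) (he : e ≠ 0) {ϖ : F}
    (hϖ : Valued.v ϖ = exp (-1 : ℤ)) {s : E} {g : Matrix (Fin 2) (Fin 2) F} (hdet : Valued.v (s • g.map ι).det = 1) :
    (∀ i j, Valued.v ((s • g.map ι) i j) ≤ 1) ↔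
      ∃ k : ℤ, (∀ i j, Valued.v ((ϖ ^ k • g) i j) ≤ 1) ∧ Valued.v (ϖ ^ k • g).det = 1 := by
  rw [v_det_smul_map_two ι hι] at hdet
  -- `v s = exp σ₀`, `v (det g) = exp δ`, `2σ₀ + eδ = 0`
  have hvs : Valued.v s ≠ 0 := by
    intro h; rw [h, zero_pow two_ne_zero, zero_mul] at hdet; exact zero_ne_one hdet
  have hvd : Valued.v g.det ≠ 0 := by
    intro h; rw [h, zero_pow he, mul_zero] at hdet; exact zero_ne_one hdet
  obtain ⟨σ₀, hσ₀⟩ : ∃ σ₀ : ℤ, Valued.v s = exp σ₀ := ⟨_, (exp_log hvs).symm⟩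
  obtain ⟨δ, hδ⟩ : ∃ δ : ℤ, Valued.v g.det = exp δ := ⟨_, (exp_log hvd).symm⟩
  have hrel : 2 * σ₀ + e * δ = 0 := by
    rw [hσ₀, hδ, ← WithZero.exp_nsmul, ← WithZero.exp_nsmul, ← WithZero.exp_add, ← WithZero.exp_zero, exp_inj] at hdet
    simpa [nsmul_eq_mul] using hdet
  -- entries and determinants in `exp`-form
  have hE : ∀ i j, Valued.v ((s • g.map ι) i j) = exp σ₀ * Valued.v (g i j) ^ e := fun i j => by
    rw [Matrix.smul_apply, Matrix.map_apply, smul_eq_mul, map_mul, hι, hσ₀]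
  have hF : ∀ (k : ℤ) (i j : Fin 2), Valued.v ((ϖ ^ k • g) i j) = exp (-k) * Valued.v (g i j) := fun k i j => by
    rw [Matrix.smul_apply, smul_eq_mul, map_mul, CartanUnique.v_uniformizer_zpow hϖ]
  have hFdet : ∀ k : ℤ, Valued.v (ϖ ^ k • g).det = exp (δ - 2 * k) := fun k => by
    rw [Matrix.det_smul, Fintype.card_fin, map_mul, map_pow, CartanUnique.v_uniformizer_zpow hϖ, hδ, ← WithZero.exp_nsmul,
      ← WithZero.exp_add]
    congr 1; simp only [nsmul_eq_mul, Nat.cast_ofNat]; ring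
  have hepos : (0 : ℤ) < e := by exact_mod_cast Nat.pos_of_ne_zero he
  constructor
  · intro hM
    -- the largest entry of `g`
    obtain ⟨p, -, hp⟩ := Finset.exists_max_image Finset.univ (fun q : Fin 2 × Fin 2 => Valued.v (g q.1 q.2)) Finset.univ_nonempty
    have hp0 : Valued.v (g p.1 p.2) ≠ 0 := by
      intro h0
      apply hvd
      have hg0 : g = 0 := by
        ext i j
        have hij := hp (i, j) (Finset.mem_univ _)
        rw [h0, le_zero_iff, map_eq_zero] at hij
        exact hij
      rw [hg0, Matrix.det_zero, map_zero]
    set m := log (Valued.v (g p.1 p.2)) with hmdef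
    have hm : Valued.v (g p.1 p.2) = exp m := (exp_log hp0).symm
    have hle : ∀ i j, Valued.v (g i j) ≤ exp m := fun i j => (hp (i, j) (Finset.mem_univ _)).trans hm.le
    have hint : ∀ i j, Valued.v ((ϖ ^ m • g) i j) ≤ 1 := fun i j => by
      rw [hF, exp_mul_le_one_iff, neg_neg]; exact hle i j
    refine ⟨m, hint, ?_⟩
    have h1 : exp σ₀ * exp m ^ e ≤ 1 := by rw [← hm, ← hE]; exact hM p.1 p.2
    have h2 : Valued.v (ϖ ^ m • g).det ≤ 1 := by
      rw [Matrix.det_fin_two]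
      refine le_trans (Valuation.map_sub _ _ _) (max_le ?_ ?_) <;> rw [map_mul] <;> exact mul_le_one' (hint _ _) (hint _ _)
    rw [hFdet] at h2 ⊢
    rw [← WithZero.exp_nsmul, ← WithZero.exp_add, ← WithZero.exp_zero, exp_le_exp, nsmul_eq_mul] at h1
    rw [← WithZero.exp_zero, exp_le_exp] at h2
    rw [← WithZero.exp_zero, exp_inj]
    have key : (e : ℤ) * (δ - 2 * m) = -2 * (σ₀ + e * m) := by linear_combination hrel
    nlinarith
  · rintro ⟨k, hk, hkdet⟩ i j
    rw [hFdet, ← WithZero.exp_zero, exp_inj] at hkdet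
    rw [hE]
    by_cases h0 : Valued.v (g i j) = 0
    · rw [h0, zero_pow he, mul_zero]; exact zero_le
    · obtain ⟨γ, hγ⟩ : ∃ γ : ℤ, Valued.v (g i j) = exp γ := ⟨_, (exp_log h0).symm⟩
      have hk' := hk i j
      rw [hF, hγ, ← WithZero.exp_add, ← WithZero.exp_zero, exp_le_exp] at hk'
      rw [hγ, ← WithZero.exp_nsmul, ← WithZero.exp_add, ← WithZero.exp_zero, exp_le_exp, nsmul_eq_mul]
      nlinarith

/-- **EDGE LEVEL (homothety classes of the Iwahori subgroup and of its coset of edge-inversions), `e = 2`.**  Let `ι : F → E` square valuations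
(`v_E(ι x) = v_F(x)²`: a totally ramified quadratic extension), `π` a uniformiser of `E`, `ϖ` a uniformiser of `F`, `M := s · ι(g)` with `v_E(det M) = 1`,
and `D_E := diag(1, π)`, `D := diag(1, ϖ)`.  Then `D_E⁻¹ M D_E` is `v_E`-integral — i.e. `M` stabilises the lattice `𝒪_E ⊕ π𝒪_E` — iff EITHER some
homothetic `ϖ^k g` fixes both lattices `Λ₀ = 𝒪_F²` and `Λ₁ = D Λ₀` (`ϖ^k g ∈ GL₂(𝒪_F)` and `D⁻¹ (ϖ^k g) D ∈ GL₂(𝒪_F)`: the Iwahori subgroup), OR the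
class of `g` SWAPS them (`D⁻¹(ϖ^k g) ∈ GL₂(𝒪_F)`, i.e. `ϖ^k g Λ₀ = Λ₁`, and `(ϖ^{k′} g) D ∈ GL₂(𝒪_F)`, i.e. `ϖ^{k′} g Λ₁ = Λ₀`: an inversion of the edge
`{Λ₀, Λ₁}` of the tree of `SL₂(F)`).  The parity of `v_F(det g)` decides the branch: entries of `ι(g)` have EVEN `E`-valuation, the scalar `s` has
`v_E(s) = v_F(det g)⁻¹`, and an odd scalar valuation is exactly an inversion.  The four `F`-side conditions are stated with independent exponents (they are
linked by the determinants), so that each reads as one lattice equation. [cite: Serre1980Trees, Ch. II §1.1–§1.3] [cite: Tits1979, §2.7] -/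
theorem forall_v_conj_smul_map_le_one_iff_of_sq (hι : ∀ x, Valued.v (ι x) = Valued.v x ^ 2) {π : E} (hπ : Valued.v π = exp (-1 : ℤ))
    {ϖ : F} (hϖ : Valued.v ϖ = exp (-1 : ℤ)) {s : E} {g : Matrix (Fin 2) (Fin 2) F} (hdet : Valued.v (s • g.map ι).det = 1) :
    (∀ i j, Valued.v ((diagonal ![1, π⁻¹] * (s • g.map ι) * diagonal ![1, π]) i j) ≤ 1) ↔
      ((∃ k : ℤ, (∀ i j, Valued.v ((ϖ ^ k • g) i j) ≤ 1) ∧ Valued.v (ϖ ^ k • g).det = 1) ∧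
        (∃ k : ℤ, (∀ i j, Valued.v ((diagonal ![1, ϖ⁻¹] * (ϖ ^ k • g) * diagonal ![1, ϖ]) i j) ≤ 1) ∧
          Valued.v (diagonal ![1, ϖ⁻¹] * (ϖ ^ k • g) * diagonal ![1, ϖ]).det = 1)) ∨
      ((∃ k : ℤ, (∀ i j, Valued.v ((diagonal ![1, ϖ⁻¹] * (ϖ ^ k • g)) i j) ≤ 1) ∧ Valued.v (diagonal ![1, ϖ⁻¹] * (ϖ ^ k • g)).det = 1) ∧
        (∃ k : ℤ, (∀ i j, Valued.v ((ϖ ^ k • g * diagonal ![1, ϖ]) i j) ≤ 1) ∧ Valued.v (ϖ ^ k • g * diagonal ![1, ϖ]).det = 1)) := by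
  rw [v_det_smul_map_two ι hι] at hdet
  -- `v s = exp σ₀`, `v (det g) = exp δ`, `σ₀ + δ = 0`
  have hvs : Valued.v s ≠ 0 := by
    intro h; rw [h, zero_pow two_ne_zero, zero_mul] at hdet; exact zero_ne_one hdet
  have hvd : Valued.v g.det ≠ 0 := by
    intro h; rw [h, zero_pow two_ne_zero, mul_zero] at hdet; exact zero_ne_one hdet
  obtain ⟨σ₀, hσ₀⟩ : ∃ σ₀ : ℤ, Valued.v s = exp σ₀ := ⟨_, (exp_log hvs).symm⟩
  obtain ⟨δ, hδ⟩ : ∃ δ : ℤ, Valued.v g.det = exp δ := ⟨_, (exp_log hvd).symm⟩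
  have hrel : σ₀ + δ = 0 := by
    rw [hσ₀, hδ, ← WithZero.exp_nsmul, ← WithZero.exp_nsmul, ← WithZero.exp_add, ← WithZero.exp_zero, exp_inj] at hdet
    simp only [nsmul_eq_mul, Nat.cast_ofNat] at hdet
    omega
  -- valuations of the diagonal scalings, in `exp`-form
  have hπ0 : π ≠ 0 := fun h => by rw [h, map_zero] at hπ; exact exp_ne_zero hπ.symm
  have hϖ0 : ϖ ≠ 0 := fun h => by rw [h, map_zero] at hϖ; exact exp_ne_zero hϖ.symm
  have hEL : ∀ i, Valued.v ((![1, π⁻¹] : Fin 2 → E) i) = exp ((![0, 1] : Fin 2 → ℤ) i) :=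
    Fin.forall_fin_two.2 ⟨by simp, by simp [map_inv₀, hπ]⟩
  have hER : ∀ j, Valued.v ((![1, π] : Fin 2 → E) j) = exp ((![0, -1] : Fin 2 → ℤ) j) :=
    Fin.forall_fin_two.2 ⟨by simp, by simp [hπ]⟩
  have hFL : ∀ i, Valued.v ((![1, ϖ⁻¹] : Fin 2 → F) i) = exp ((![0, 1] : Fin 2 → ℤ) i) :=
    Fin.forall_fin_two.2 ⟨by simp, by simp [map_inv₀, hϖ]⟩
  have hFR : ∀ j, Valued.v ((![1, ϖ] : Fin 2 → F) j) = exp ((![0, -1] : Fin 2 → ℤ) j) :=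
    Fin.forall_fin_two.2 ⟨by simp, by simp [hϖ]⟩
  have hdetL : Valued.v (diagonal (![1, ϖ⁻¹] : Fin 2 → F)).det = exp 1 := by
    rw [det_diagonal, Fin.prod_univ_two, map_mul, hFL, hFL, ← WithZero.exp_add]; rfl
  have hdetR : Valued.v (diagonal (![1, ϖ] : Fin 2 → F)).det = exp (-1) := by
    rw [det_diagonal, Fin.prod_univ_two, map_mul, hFR, hFR, ← WithZero.exp_add]; rfl
  have hdet0 : ∀ k : ℤ, Valued.v (ϖ ^ k • g).det = exp (δ - 2 * k) := fun k => by
    rw [Matrix.det_smul, Fintype.card_fin, map_mul, map_pow, CartanUnique.v_uniformizer_zpow hϖ, hδ, ← WithZero.exp_nsmul,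
      ← WithZero.exp_add]
    congr 1; simp only [nsmul_eq_mul, Nat.cast_ofNat]; ring
  -- the four `E`-side entry conditions and the sixteen `F`-side ones, as bounds on `v (g i j)`; the determinants as integer equations
  have hN : ∀ i j, Valued.v ((diagonal ![1, π⁻¹] * (s • g.map ι) * diagonal ![1, π]) i j) ≤ 1 ↔
      Valued.v (g i j) ≤ exp (-((![0, 1] : Fin 2 → ℤ) i + (![0, -1] : Fin 2 → ℤ) j + σ₀) / 2) := fun i j => by
    rw [v_diagonal_mul_smul_map_mul_diagonal_apply ι hι, hEL, hER, hσ₀, exp_mul_exp_mul_exp_mul_pow_two_le_one_iff]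
  have hU0 : ∀ (k : ℤ) (i j : Fin 2), Valued.v ((ϖ ^ k • g) i j) ≤ 1 ↔ Valued.v (g i j) ≤ exp k := fun k i j => by
    rw [v_zpow_smul_apply hϖ, exp_mul_le_one_iff, neg_neg]
  have hU1 : ∀ (k : ℤ) (i j : Fin 2), Valued.v ((diagonal ![1, ϖ⁻¹] * (ϖ ^ k • g) * diagonal ![1, ϖ]) i j) ≤ 1 ↔
      Valued.v (g i j) ≤ exp (-((![0, 1] : Fin 2 → ℤ) i + (![0, -1] : Fin 2 → ℤ) j + -k)) := fun k i j => by
    rw [v_diagonal_mul_zpow_smul_mul_diagonal_apply hϖ, hFL, hFR, exp_mul_exp_mul_exp_mul_le_one_iff]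
  have hU2 : ∀ (k : ℤ) (i j : Fin 2), Valued.v ((diagonal ![1, ϖ⁻¹] * (ϖ ^ k • g)) i j) ≤ 1 ↔
      Valued.v (g i j) ≤ exp (-((![0, 1] : Fin 2 → ℤ) i + -k)) := fun k i j => by
    rw [v_diagonal_mul_zpow_smul_apply hϖ, hFL, exp_mul_exp_mul_le_one_iff]
  have hU3 : ∀ (k : ℤ) (i j : Fin 2), Valued.v ((ϖ ^ k • g * diagonal ![1, ϖ]) i j) ≤ 1 ↔
      Valued.v (g i j) ≤ exp (-((![0, -1] : Fin 2 → ℤ) j + -k)) := fun k i j => by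
    rw [v_zpow_smul_mul_diagonal_apply hϖ, hFR, exp_mul_exp_mul_le_one_iff]
  have hD0 : ∀ k : ℤ, Valued.v (ϖ ^ k • g).det = 1 ↔ δ - 2 * k = 0 := fun k => by
    rw [hdet0, ← WithZero.exp_zero, exp_inj]
  have hD1 : ∀ k : ℤ, Valued.v (diagonal ![1, ϖ⁻¹] * (ϖ ^ k • g) * diagonal ![1, ϖ]).det = 1 ↔ δ - 2 * k = 0 := fun k => by
    rw [det_mul, det_mul, map_mul, map_mul, hdetL, hdetR, hdet0, ← WithZero.exp_add, ← WithZero.exp_add, ← WithZero.exp_zero, exp_inj]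
    omega
  have hD2 : ∀ k : ℤ, Valued.v (diagonal ![1, ϖ⁻¹] * (ϖ ^ k • g)).det = 1 ↔ δ - 2 * k + 1 = 0 := fun k => by
    rw [det_mul, map_mul, hdetL, hdet0, ← WithZero.exp_add, ← WithZero.exp_zero, exp_inj]
    omega
  have hD3 : ∀ k : ℤ, Valued.v (ϖ ^ k • g * diagonal ![1, ϖ]).det = 1 ↔ δ - 2 * k - 1 = 0 := fun k => by
    rw [det_mul, map_mul, hdetR, hdet0, ← WithZero.exp_add, ← WithZero.exp_zero, exp_inj]
    omega
  simp only [hN, hU0, hU1, hU2, hU3, hD0, hD1, hD2, hD3, Fin.forall_fin_two, cons_val_zero, cons_val_one]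
  -- pure bookkeeping on the exponents
  constructor
  · rintro ⟨⟨h00, h01⟩, h10, h11⟩
    obtain ⟨a, ha | ha⟩ := Int.even_or_odd' δ
    · -- `v(det g)` even: the class of `g` fixes `Λ₀` and `Λ₁`
      refine Or.inl ⟨⟨a, ⟨⟨?_, ?_⟩, ?_, ?_⟩, by omega⟩, ⟨a, ⟨⟨?_, ?_⟩, ?_, ?_⟩, by omega⟩⟩
      all_goals first
        | exact le_exp_of_le_exp_of_le h00 (by omega) | exact le_exp_of_le_exp_of_le h01 (by omega)
        | exact le_exp_of_le_exp_of_le h10 (by omega) | exact le_exp_of_le_exp_of_le h11 (by omega)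
    · -- `v(det g)` odd: the class of `g` swaps `Λ₀` and `Λ₁`
      refine Or.inr ⟨⟨a + 1, ⟨⟨?_, ?_⟩, ?_, ?_⟩, by omega⟩, ⟨a, ⟨⟨?_, ?_⟩, ?_, ?_⟩, by omega⟩⟩
      all_goals first
        | exact le_exp_of_le_exp_of_le h00 (by omega) | exact le_exp_of_le_exp_of_le h01 (by omega)
        | exact le_exp_of_le_exp_of_le h10 (by omega) | exact le_exp_of_le_exp_of_le h11 (by omega)
  · rintro (⟨⟨k₀, ⟨⟨a00, a01⟩, a10, a11⟩, hk₀⟩, ⟨k₁, ⟨⟨b00, b01⟩, b10, b11⟩, hk₁⟩⟩ | ⟨⟨k₂, ⟨⟨a00, a01⟩, a10, a11⟩, hk₂⟩, ⟨k₃, ⟨⟨b00, b01⟩, b10, b11⟩, hk₃⟩⟩)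
    · refine ⟨⟨?_, ?_⟩, ?_, ?_⟩
      · exact le_exp_of_le_exp_of_le a00 (by omega)
      · exact le_exp_of_le_exp_of_le a01 (by omega)
      · exact le_exp_of_le_exp_of_le b10 (by omega)
      · exact le_exp_of_le_exp_of_le a11 (by omega)
    · refine ⟨⟨?_, ?_⟩, ?_, ?_⟩
      · exact le_exp_of_le_exp_of_le b00 (by omega)
      · exact le_exp_of_le_exp_of_le b01 (by omega)
      · exact le_exp_of_le_exp_of_le b10 (by omega)
      · exact le_exp_of_le_exp_of_le a11 (by omega)

omit [Valued F ℤᵐ⁰] [Valued E ℤᵐ⁰] in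
/-- **Transport along an `F`-rational diagonal**: `D_E⁻¹ (s · ι g) D_E = s · ι(D⁻¹ g D)` for `D = diag(d)`, `D_E = diag(ι ∘ d)` (as formal
inverses `diag(d⁻¹)`; no invertibility needed) — so the VERTEX LEVEL criterion at the neighbouring vertex `Λ₁ = diag(1, ϖ) Λ₀` is the same criterion
for `diag(1,ϖ)⁻¹ g diag(1,ϖ)`. [cite: Serre1980Trees, Ch. II §1.1–§1.3] -/
theorem diagonal_map_inv_mul_smul_map_mul_diagonal_map (d : Fin 2 → F) (s : E) (g : Matrix (Fin 2) (Fin 2) F) :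
    diagonal (fun i => (ι (d i))⁻¹) * (s • g.map ι) * diagonal (fun i => ι (d i)) =
      s • (diagonal (fun i => (d i)⁻¹) * g * diagonal d).map ι := by
  ext i j
  simp only [diagonal_mul_mul_diagonal_apply, Matrix.smul_apply, Matrix.map_apply, smul_eq_mul, map_mul, map_inv₀]
  ring

omit [Valued F ℤᵐ⁰] [Valued E ℤᵐ⁰] in
/-- `F`-rational diagonal transport, `diag(1, ϖ)` version: `diag(1, ι ϖ)⁻¹ (s · ι g) diag(1, ι ϖ) = s · ι(diag(1,ϖ)⁻¹ g diag(1,ϖ))`. [cite: Serre1980Trees, Ch. II §1.1–§1.3] -/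
theorem diagonal_map_inv_mul_smul_map_mul_diagonal_map_two (ϖ : F) (s : E) (g : Matrix (Fin 2) (Fin 2) F) :
    diagonal ![1, (ι ϖ)⁻¹] * (s • g.map ι) * diagonal ![1, ι ϖ] = s • (diagonal ![1, ϖ⁻¹] * g * diagonal ![1, ϖ]).map ι := by
  have h := diagonal_map_inv_mul_smul_map_mul_diagonal_map ι ![1, ϖ] s g
  have h1 : (fun i => (ι ((![1, ϖ] : Fin 2 → F) i))⁻¹) = ![1, (ι ϖ)⁻¹] := by
    funext i; fin_cases i <;> simp
  have h2 : (fun i => ι ((![1, ϖ] : Fin 2 → F) i)) = ![1, ι ϖ] := by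
    funext i; fin_cases i <;> simp
  have h3 : (fun i => ((![1, ϖ] : Fin 2 → F) i)⁻¹) = ![1, ϖ⁻¹] := by
    funext i; fin_cases i <;> simp
  rw [h1, h2, h3] at h
  exact h

/-- **VERTEX LEVEL AT THE NEIGHBOUR `Λ₁ = diag(1,ϖ) Λ₀`**: `diag(1, ι ϖ)⁻¹ · (s · ι g) · diag(1, ι ϖ)` is `v_E`-integral iff some homothetic
`ϖ^k g` satisfies `diag(1,ϖ)⁻¹ (ϖ^k g) diag(1,ϖ) ∈ GL₂(𝒪_F)`, i.e. iff `[g]` fixes `Λ₁` ((A) transported along (C)). [cite: Serre1980Trees, Ch. II §1.1–§1.3] -/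
theorem forall_v_conj_map_smul_map_le_one_iff_exists_zpow_smul (hι : ∀ x, Valued.v (ι x) = Valued.v x ^ e) (he : e ≠ 0) {ϖ : F}
    (hϖ : Valued.v ϖ = exp (-1 : ℤ)) {s : E} {g : Matrix (Fin 2) (Fin 2) F} (hdet : Valued.v (s • g.map ι).det = 1) :
    (∀ i j, Valued.v ((diagonal ![1, (ι ϖ)⁻¹] * (s • g.map ι) * diagonal ![1, ι ϖ]) i j) ≤ 1) ↔
      ∃ k : ℤ, (∀ i j, Valued.v ((diagonal ![1, ϖ⁻¹] * (ϖ ^ k • g) * diagonal ![1, ϖ]) i j) ≤ 1) ∧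
        Valued.v (diagonal ![1, ϖ⁻¹] * (ϖ ^ k • g) * diagonal ![1, ϖ]).det = 1 := by
  have hϖ0 : ϖ ≠ 0 := fun h => by rw [h, map_zero] at hϖ; exact exp_ne_zero hϖ.symm
  have hdet' : Valued.v (s • (diagonal ![1, ϖ⁻¹] * g * diagonal ![1, ϖ]).map ι).det = 1 := by
    rw [v_det_smul_map_two ι hι] at hdet ⊢
    have hD1 : (diagonal ![(1 : F), ϖ⁻¹]).det = ϖ⁻¹ := by rw [det_diagonal, Fin.prod_univ_two]; simp
    have hD2 : (diagonal ![(1 : F), ϖ]).det = ϖ := by rw [det_diagonal, Fin.prod_univ_two]; simp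
    rwa [det_mul, det_mul, hD1, hD2, mul_right_comm, inv_mul_cancel₀ hϖ0, one_mul]
  rw [diagonal_map_inv_mul_smul_map_mul_diagonal_map_two, forall_v_smul_map_le_one_iff_exists_zpow_smul ι hι he hϖ hdet']
  simp only [Matrix.mul_smul, Matrix.smul_mul]

end TwoFields

end Literature.NumberTheory.Automorphic
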